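import Mathlib
import Literature.AlgebraicGeometry.Resolution.SmoothOfRegularFibre
import Literature.AlgebraicGeometry.Resolution.RegularLocalRingsQuotient
import HarnessLib

/-!
# Good reduction at a point of the special fibre gives a smooth neighbourhood

Stub `exists_smooth_nhd_of_goodAt` of the line `strata-split` for the crux `EquisingularLift`
(stmt-ResolutionOfSingularities-15660).

Let `O` be a discrete valuation ring with algebraically closed residue field `κ`, and
`r₁ : P₁ → Spec O` flat and locally of finite presentation. Let `y ∈ P₁` lie over the closed
point, with `𝒪_{P₁,y}` a regular local ring and, for every uniformizer `ϖ` of `O`, the germ at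
`y` of `r₁♯(ϖ)` outside `𝔪_y²` ("good reduction of the ambient at `y`"). Then `y` has an open
neighbourhood `U` with `U ↪ P₁ → Spec O` smooth.

Proof (EGA IV₄ 17.5.1 / Stacks 01V8, fibrewise criterion of smoothness): with
`R := 𝒪_{Spec O, r₁ y} = O_{𝔪} ≅ O` and `S := 𝒪_{P₁,y}`, the maximal ideal of `R` is generated by
the image of a uniformizer `ϖ`, whose image in `S` is the germ `g` of `r₁♯(ϖ)`; so the local ring
of the fibre `S/𝔪_R S = S/(g)` is regular, `S` being regular and `g ∈ 𝔪_S ∖ 𝔪_S²`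
(Matsumura 14.2, tree `IsRegularLocalRing.quotient_span_singleton`). The residue field
`κ(r₁ y) ≅ κ` is algebraically closed, hence perfect, so `y` lies in the open smooth locus of `r₁`
(tree `mem_smoothLocus_of_isRegularLocalRing_stalk_fiber`), whence a smooth open neighbourhood
(tree `exists_smooth_ι_comp_of_mem_smoothLocus`).

References: A. Grothendieck, J. Dieudonné, *EGA IV₄*, Publ. Math. IHÉS 32 (1967), Thm. 17.5.1;
The Stacks Project, Tag 01V8; H. Matsumura, *Commutative Ring Theory*, CUP 1986, Thm. 14.2.
-/

set_option linter.dupNamespace false -- mandated namespace of this single-conjunct summit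
set_option linter.overlappingInstances false -- the registered signature carries both [IsDomain O] and [IsDiscreteValuationRing O] (Mathlib's class takes the former as a parameter)

namespace Summit.ResolutionOfSingularities.ResolutionOfSingularities.Cruxes.EquisingularLift.StrataSplit

open CategoryTheory AlgebraicGeometry TopologicalSpace
open IsLocalRing Literature.AlgebraicGeometry.Resolution

/-- The stalk map `𝒪_{Y, q y} ⟶ 𝒪_{P, y}` sends the germ at `q y` of a global section `s` to the
germ at `y` of the pulled-back global section `q.appTop s`. -/
theorem stalkMap_Γgerm_apply' {P Y : Scheme.{0}} (q : P ⟶ Y) (y : P) (s : Γ(Y, ⊤)) :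
    (q.stalkMap y).hom ((Y.presheaf.Γgerm (q y)).hom s) =
      (P.presheaf.Γgerm y).hom (q.appTop.hom s) := by
  -- adapted from Theorems/EquisingularLiftEquisingularLiftGoodAtOverIso.lean
  simp only [TopCat.Presheaf.Γgerm]
  rw [Scheme.Hom.germ_stalkMap_apply]
  rfl

/-- For a ring `O` and a point `p` of `Spec O`, the structure map `O → 𝒪_{Spec O, p}` sends
`ϖ` to the germ at `p` of the global section `ϖ` (read through `Γ(Spec O, ⊤) ≅ O`). -/
theorem algebraMap_stalk_eq_Γgerm (O : Type) [CommRing O] (p : Spec (.of O)) (ϖ : O) :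
    letI : Algebra O ((Spec (.of O)).presheaf.stalk p) := StructureSheaf.stalkAlgebra O p
    algebraMap O ((Spec (.of O)).presheaf.stalk p) ϖ =
      ((Spec (.of O)).presheaf.Γgerm p).hom ((Scheme.ΓSpecIso (CommRingCat.of O)).inv.hom ϖ) :=
  rfl

/-- **`exists_smooth_nhd_of_goodAt`.** Let `O` be a discrete valuation ring with algebraically
closed residue field and `r₁ : P₁ → Spec O` flat and locally of finite presentation. If `y` lies
on the special fibre, `𝒪_{P₁,y}` is regular and the germ at `y` of every uniformizer lies outside
`𝔪_y²`, then `r₁` is smooth on an open neighbourhood of `y`: the local ring of the fibre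
`𝒪_{P₁,y}/(ϖ)` is regular (Matsumura 14.2) over the perfect field `κ`, so the fibrewise
criterion of smoothness (EGA IV₄ 17.5.1 / Stacks 01V8) puts `y` in the open smooth locus.
[cite: StacksProject, Tag 01V8] -/
theorem exists_smooth_nhd_of_goodAt : ∀ (O : Type) [CommRing O] [IsDomain O] [IsDiscreteValuationRing O]
    [IsAlgClosed (IsLocalRing.ResidueField O)] (P₁ : AlgebraicGeometry.Scheme.{0})
    (r₁ : P₁ ⟶ AlgebraicGeometry.Spec (.of O)),
    AlgebraicGeometry.LocallyOfFinitePresentation r₁ → AlgebraicGeometry.Flat r₁ →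
    ∀ y : P₁, r₁ y = IsLocalRing.closedPoint O →
    (IsRegularLocalRing (P₁.presheaf.stalk y) ∧
      ∀ ϖ : O, Irreducible ϖ → (P₁.presheaf.Γgerm y).hom
        (r₁.appTop.hom ((AlgebraicGeometry.Scheme.ΓSpecIso (CommRingCat.of O)).inv.hom ϖ)) ∉
        (IsLocalRing.maximalIdeal (P₁.presheaf.stalk y)) ^ 2) →
    ∃ U : P₁.Opens, y ∈ U ∧ AlgebraicGeometry.Smooth (U.ι ≫ r₁) := by
  intro O _ _ _ _ P₁ r₁ hfp hfl y hy hgood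
  haveI := hfp
  haveI := hfl
  obtain ⟨hreg, hgood⟩ := hgood
  haveI := hreg
  obtain ⟨ϖ, hirr⟩ := IsDiscreteValuationRing.exists_irreducible O
  -- the local rings `R = 𝒪_{Spec O, r₁ y}` and `S = 𝒪_{P₁, y}`
  set R := (Spec (.of O)).presheaf.stalk (r₁ y)
  set S := P₁.presheaf.stalk y
  letI : Algebra R S := (r₁.stalkMap y).hom.toAlgebra
  haveI : IsLocalHom (algebraMap R S) := inferInstanceAs (IsLocalHom (r₁.stalkMap y).hom)
  -- `R` is the localization of `O` at the closed point, i.e. `O → R` is bijective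
  letI : Algebra O R := StructureSheaf.stalkAlgebra O (r₁ y)
  haveI : IsLocalization.AtPrime R (r₁ y).asIdeal := StructureSheaf.IsLocalization.to_stalk O (r₁ y)
  have hpy : (r₁ y).asIdeal = maximalIdeal O := by rw [hy]; rfl
  have hunits : (r₁ y).asIdeal.primeCompl ≤ IsUnit.submonoid O := fun x hx => by
    rw [hy] at hx
    exact not_not.mp hx
  let eOR : O ≃ₐ[O] R := IsLocalization.atUnits O (r₁ y).asIdeal.primeCompl hunits
  -- the residue field `κ(r₁ y) ≅ κ` is algebraically closed, hence perfect
  haveI : IsAlgClosed ((Spec (.of O)).residueField (r₁ y)) :=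
    IsAlgClosed.of_ringEquiv (ResidueField O) _ (ResidueField.mapEquiv eOR.toRingEquiv)
  haveI : PerfectField ((Spec (.of O)).residueField (r₁ y)) := IsAlgClosed.perfectField _
  -- `𝔪_R S` is generated by the germ `g` of `r₁♯(ϖ)`
  have hmR : maximalIdeal R = (maximalIdeal O).map (algebraMap O R) := by
    rw [← hpy]
    exact (IsLocalization.AtPrime.map_eq_maximalIdeal (r₁ y).asIdeal R).symm
  have hgalg : algebraMap R S (algebraMap O R ϖ) = (P₁.presheaf.Γgerm y).hom
      (r₁.appTop.hom ((Scheme.ΓSpecIso (CommRingCat.of O)).inv.hom ϖ)) := by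
    rw [algebraMap_stalk_eq_Γgerm]
    exact stalkMap_Γgerm_apply' r₁ y _
  have hmap : (maximalIdeal R).map (r₁.stalkMap y).hom = Ideal.span {(P₁.presheaf.Γgerm y).hom
      (r₁.appTop.hom ((Scheme.ΓSpecIso (CommRingCat.of O)).inv.hom ϖ))} := by
    rw [← hgalg, hmR, hirr.maximalIdeal_eq, Ideal.map_span, Set.image_singleton, Ideal.map_span,
      Set.image_singleton]
    rfl
  -- `g ∈ 𝔪_S ∖ 𝔪_S²`, so the local ring `S/(g)` of the fibre is regular
  have hgm : (P₁.presheaf.Γgerm y).hom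
      (r₁.appTop.hom ((Scheme.ΓSpecIso (CommRingCat.of O)).inv.hom ϖ)) ∈ maximalIdeal S := by
    rw [← hgalg]
    refine map_nonunit (algebraMap R S) _ ?_
    rw [hmR]
    exact Ideal.mem_map_of_mem _ ((mem_maximalIdeal ϖ).mpr hirr.not_isUnit)
  have hq := (IsRegularLocalRing.quotient_span_singleton hgm (hgood ϖ hirr)).1
  haveI : IsRegularLocalRing (S ⧸ (maximalIdeal R).map (r₁.stalkMap y).hom) :=
    IsRegularLocalRing.of_ringEquiv (Ideal.quotEquivOfEq hmap.symm)
  obtain ⟨e₀⟩ := Literature.AlgebraicGeometry.Motives.nonempty_stalkFiber_ringEquiv_asFiber r₁ y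
  have hfib : IsRegularLocalRing ((r₁.fiber (r₁ y)).presheaf.stalk (r₁.asFiber y)) :=
    IsRegularLocalRing.of_ringEquiv e₀.symm
  -- fibrewise criterion of smoothness
  exact exists_smooth_ι_comp_of_mem_smoothLocus r₁
    (mem_smoothLocus_of_isRegularLocalRing_stalk_fiber r₁ y hfib)

end Summit.ResolutionOfSingularities.ResolutionOfSingularities.Cruxes.EquisingularLift.StrataSplit
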